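import Mathlib
import Literature.MeasureTheory.Hausdorff.SphereArea
import Summits.FinalStateConjecture.FinalStateConjecture.Statement
import Summits.FinalStateConjecture.FinalStateConjecture.Theorems.EIHFluxBalanceInertialRecessionAnsatzSmooth
import Summits.FinalStateConjecture.FinalStateConjecture.Theorems.EIHFluxBalanceInertialRecessionLorentz
import Summits.FinalStateConjecture.FinalStateConjecture.Theorems.EIHFluxBalanceInertialRecessionChartCalculus
import HarnessLib

/-!
# Route EIHFluxBalance — crux `InertialRecession` (stmt-FinalStateConjecture-10166): stub `stub_wallInflux`

Line `momentum-variation-is-paid-in-energy` (Cruxes/InertialRecession/Lines/…, STUB 3, "far-influx budget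
from the cone weight"). Registered stub, proved here verbatim (name + signature).

**Statement.** Under the antecedent of `InertialRecession` with at least one hole (`0 < N`) and for every
wall speed `κ² < κ′ < κ`, there is `T` such that the energy exposure of the deviation
`h = Φ^* g − G(λ(t))` (all derivative orders `m ≤ 3`, squared) through the receding coordinate wall
`{x⁰ = t, |y| = κ′t}`, integrated against the Euclidean Hausdorff surface measure `μHE[2]`, is
integrable on `(T, ∞)`.

**Proof** (pure analysis; no field equations). Eventually `‖ξᵢ(t)‖ ≤ κ²t` for all `i` (cone clause),
so a wall point `x = (t, y)`, `|y| = κ′t`, is at lab distance `d ≥ (κ′ − κ²)t` from every painted centre;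
boosts only stretch spatial separations (`sq_sub_sq_le_radius_poincareInv_sq`), so its painted radii are
`≥ √(d² − aᵢ²) > rinᵢ` and `x ∈ U`; and `|y| ≤ κt`. The weighted clause (vi) is eventually `≤ 1`, whence
`(1 + d^{7/4}) ‖D^m h(x)‖ ≤ 1`, `Σ_{m ≤ 3} ‖D^m h(x)‖² ≤ 4 ((κ′−κ²)t)^{-7/2}`, and with
`μHE[2](S_{κ′t}) = 4π(κ′t)²` the wall integral is `≤ 16πκ′² (κ′−κ²)^{-7/2} · t^{-3/2} ∈ L¹(T, ∞)` — the one
place where `7/4 > 3/2` is spent (Disproof `weight_window`). Measurability in `t`: by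
`setIntegral_sphere_euclideanHausdorff_three` the wall integral is `(κ′t)² ∫_{S²} P(t · (1, κ′ω)) dσ(ω)` with
`P = Σ‖D^m h‖²` continuous on an open wall-neighbourhood `W ⊆ U` on which `h` is `C^∞`
(`contDiffAt_deviationExtend_of_bilin`; the ansatz is smooth wherever all painted radii are positive), so it
is continuous on `(T, ∞)` by dominated convergence on the finite measure `volume.toSphere`.
-/

noncomputable section

open scoped BigOperators Topology Manifold Classical MeasureTheory Matrix ContDiff ENNReal
open Filter Set Function TopologicalSpace MeasureTheory Literature.Geometry.Lorentzian

namespace Summit.FinalStateConjecture.FinalStateConjecture.Theorems.InertialRecession.WallInflux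

/-! ### Coordinate bookkeeping on the wall -/

/-- `(t, t•w) = t • (1, w)`: points of the receding wall at lab time `t` are the `t`-multiples of the
points of the wall at time `1`. [folklore] -/
theorem ofTimeSpace_self_smul (t : ℝ) (w : E3) :
    E4.ofTimeSpace t (t • w) = t • E4.ofTimeSpace 1 w := by
  rw [E4.ofTimeSpace_eq_smul_add' t, E4.ofTimeSpace_eq_smul_add' 1, map_smul, smul_add, smul_smul,
    mul_one]

/-- Reverse triangle inequality on the wall: if `‖y‖ = κ′t` and `‖ξ‖ ≤ κ²t` then
`(κ′ − κ²) t ≤ ‖y − ξ‖`. [folklore] -/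
theorem sub_mul_le_norm_sub {y ξ : E3} {κ κ' t : ℝ} (hy : ‖y‖ = κ' * t) (hξ : ‖ξ‖ ≤ κ ^ 2 * t) :
    (κ' - κ ^ 2) * t ≤ ‖y - ξ‖ := by
  have h := norm_sub_norm_le y ξ
  rw [hy] at h
  linarith

/-- `√(s⁷) = s³ √s` for `s ≥ 0`. [folklore] -/
theorem sqrt_pow_seven {s : ℝ} (hs : 0 ≤ s) : √(s ^ 7) = s ^ 3 * √s := by
  rw [show s ^ 7 = (s ^ 3) ^ 2 * s by ring, Real.sqrt_mul (by positivity), Real.sqrt_sq (by positivity)]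

/-- `t^{-3/2} = (t √t)⁻¹` for `t > 0`. [folklore] -/
theorem rpow_neg_three_halves {t : ℝ} (ht : 0 < t) : t ^ (-(3 / 2 : ℝ)) = (t * √t)⁻¹ := by
  rw [Real.rpow_neg ht.le, show (3 / 2 : ℝ) = 1 + 1 / 2 by norm_num, Real.rpow_add ht, Real.rpow_one,
    ← Real.sqrt_eq_rpow]

/-! ### The three analytic steps, as context-free lemmas -/

/-- **Pointwise wall bound from the weighted clause.** If at lab time `t > 0` the weighted `C³` size of
`h` on the solid cone `{x⁰ = t, |x̲| ≤ κt} ∩ U` is at most `1` (weight `1 + d^{7/4}`, `d` the lab distance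
to the nearest centre), all centres satisfy `‖ξᵢ(t)‖ ≤ κ²t`, and `κ² < κ′ < κ`, then at every wall point
`x = (t, y)`, `|y| = κ′t`, lying in `U`: `Σ_{m ≤ 3} ‖D^m h(x)‖² ≤ 4 ((κ′ − κ²)t)^{-7/2}`
(`d ≥ (κ′ − κ²)t` by the reverse triangle inequality). [folklore] -/
theorem wall_pointwise_bound {G : Type*} [NormedAddCommGroup G] [NormedSpace ℝ G]
    {N : ℕ} [Nonempty (Fin N)] {U : Opens E4} {h : E4 → G} {ξ : Fin N → ℝ → E3}
    {κ κ' t : ℝ} (ht : 0 < t) (hκ' : κ' < κ) (hc : 0 < κ' - κ ^ 2)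
    (hcone : ∀ i, ‖ξ i t‖ ≤ κ ^ 2 * t)
    (hsup : (⨆ x ∈ {x : U | x.1 0 = t ∧ E4.spatialNorm x.1 ≤ κ * t}, ⨆ (m : ℕ) (_ : m ≤ 3),
      ENNReal.ofReal (1 + √(√((⨅ i, ‖E4.spatial x.1 - ξ i t‖) ^ 7))) *
        ‖iteratedFDeriv ℝ m h x.1‖ₑ) ≤ 1)
    {y : E3} (hy : ‖y‖ = κ' * t) (hyU : E4.ofTimeSpace t y ∈ U) :
    ∑ m ∈ Finset.range 4, ‖iteratedFDeriv ℝ m h (E4.ofTimeSpace t y)‖ ^ 2 ≤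
      4 / √(((κ' - κ ^ 2) * t) ^ 7) := by
  have hzS : (⟨E4.ofTimeSpace t y, hyU⟩ : U) ∈
      {x : U | x.1 0 = t ∧ E4.spatialNorm x.1 ≤ κ * t} := by
    refine ⟨?_, ?_⟩
    · show E4.ofTimeSpace t y 0 = t
      rw [E4.ofTimeSpace_apply_zero]
    · show E4.spatialNorm (E4.ofTimeSpace t y) ≤ κ * t
      rw [E4.spatialNorm_ofTimeSpace, hy]
      exact (mul_lt_mul_of_pos_right hκ' ht).le
  have hdc : (κ' - κ ^ 2) * t ≤ ⨅ i, ‖E4.spatial (E4.ofTimeSpace t y) - ξ i t‖ := by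
    refine le_ciInf fun i ↦ ?_
    rw [E4.spatial_ofTimeSpace]
    exact sub_mul_le_norm_sub hy (hcone i)
  have hct0 : 0 < (κ' - κ ^ 2) * t := by positivity
  have hw0 : 0 < 1 + √(√((⨅ i, ‖E4.spatial (E4.ofTimeSpace t y) - ξ i t‖) ^ 7)) := by positivity
  have hww : √(√(((κ' - κ ^ 2) * t) ^ 7)) ≤
      1 + √(√((⨅ i, ‖E4.spatial (E4.ofTimeSpace t y) - ξ i t‖) ^ 7)) := by
    have : √(√(((κ' - κ ^ 2) * t) ^ 7)) ≤
        √(√((⨅ i, ‖E4.spatial (E4.ofTimeSpace t y) - ξ i t‖) ^ 7)) := by gcongr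
    linarith [this]
  have hDm : ∀ m ∈ Finset.range 4, ‖iteratedFDeriv ℝ m h (E4.ofTimeSpace t y)‖ ^ 2 ≤
      1 / √(((κ' - κ ^ 2) * t) ^ 7) := by
    intro m hm
    have hm3 : m ≤ 3 := Nat.lt_succ_iff.mp (Finset.mem_range.mp hm)
    have key : ENNReal.ofReal (1 + √(√((⨅ i, ‖E4.spatial (E4.ofTimeSpace t y) - ξ i t‖) ^ 7))) *
        ‖iteratedFDeriv ℝ m h (E4.ofTimeSpace t y)‖ₑ ≤ 1 := by
      refine le_trans ?_ hsup
      exact le_iSup₂_of_le ⟨E4.ofTimeSpace t y, hyU⟩ hzS (le_iSup₂_of_le m hm3 le_rfl)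
    rw [← ofReal_norm, ← ENNReal.ofReal_mul hw0.le, ← ENNReal.ofReal_one,
      ENNReal.ofReal_le_ofReal_iff zero_le_one] at key
    have hD0 := norm_nonneg (iteratedFDeriv ℝ m h (E4.ofTimeSpace t y))
    have hs0 : 0 < √(√(((κ' - κ ^ 2) * t) ^ 7)) := by positivity
    have hle : ‖iteratedFDeriv ℝ m h (E4.ofTimeSpace t y)‖ ≤ 1 / √(√(((κ' - κ ^ 2) * t) ^ 7)) := by
      rw [le_div_iff₀ hs0]
      calc ‖iteratedFDeriv ℝ m h (E4.ofTimeSpace t y)‖ * √(√(((κ' - κ ^ 2) * t) ^ 7))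
          ≤ ‖iteratedFDeriv ℝ m h (E4.ofTimeSpace t y)‖ *
            (1 + √(√((⨅ i, ‖E4.spatial (E4.ofTimeSpace t y) - ξ i t‖) ^ 7))) := by gcongr
        _ = (1 + √(√((⨅ i, ‖E4.spatial (E4.ofTimeSpace t y) - ξ i t‖) ^ 7))) *
            ‖iteratedFDeriv ℝ m h (E4.ofTimeSpace t y)‖ := mul_comm _ _
        _ ≤ 1 := key
    calc ‖iteratedFDeriv ℝ m h (E4.ofTimeSpace t y)‖ ^ 2
        ≤ (1 / √(√(((κ' - κ ^ 2) * t) ^ 7))) ^ 2 := pow_le_pow_left₀ hD0 hle 2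
      _ = 1 / √(((κ' - κ ^ 2) * t) ^ 7) := by
        rw [div_pow, one_pow, Real.sq_sqrt (Real.sqrt_nonneg _)]
  calc ∑ m ∈ Finset.range 4, ‖iteratedFDeriv ℝ m h (E4.ofTimeSpace t y)‖ ^ 2
      ≤ ∑ m ∈ Finset.range 4, 1 / √(((κ' - κ ^ 2) * t) ^ 7) := Finset.sum_le_sum hDm
    _ = 4 / √(((κ' - κ ^ 2) * t) ^ 7) := by
      rw [Finset.sum_const, Finset.card_range, nsmul_eq_mul]
      push_cast
      ring

/-- **The wall integral is continuous in the lab time** on `(T, ∞)` (`T > 0`), for an integrand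
`P` continuous on an open set `W` containing all wall points `(t, y)`, `|y| = κ′t`, `t > T`, and bounded
on them: by the polar form of the Hausdorff sphere integral
(`setIntegral_sphere_euclideanHausdorff_three`) the wall integral is
`(κ′t)² ∫_{S²} P(t · (1, κ′ω)) dσ(ω)`, `σ = volume.toSphere` finite, and dominated convergence applies.
[folklore] -/
theorem continuousOn_wallIntegral {P : E4 → ℝ} {W : Set E4} (hP : ContinuousOn P W)
    {κ' T C : ℝ} (hT : 0 < T) (hκ' : 0 < κ')
    (hmem : ∀ t, T < t → ∀ y : E3, ‖y‖ = κ' * t → E4.ofTimeSpace t y ∈ W)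
    (hbd : ∀ t, T < t → ∀ y : E3, ‖y‖ = κ' * t → |P (E4.ofTimeSpace t y)| ≤ C) :
    ContinuousOn (fun t ↦ ∫ y in Metric.sphere (0 : E3) (κ' * t), P (E4.ofTimeSpace t y)
      ∂(μHE[2] : Measure E3)) (Set.Ioi T) := by
  -- the wall point over the direction `α` at lab time `t` is `t • e α`
  set e : Metric.sphere (0 : E3) 1 → E4 := fun α ↦ E4.ofTimeSpace 1 (κ' • (α : E3)) with he
  have he_cont : Continuous e :=
    (E4.continuous_ofTimeSpace 1).comp (continuous_subtype_val.const_smul κ')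
  have hnorm : ∀ t, 0 < t → ∀ α : Metric.sphere (0 : E3) 1, ‖(κ' * t) • (α : E3)‖ = κ' * t := by
    intro t ht α
    rw [norm_smul, Real.norm_of_nonneg (by positivity), norm_eq_of_mem_sphere α, mul_one]
  have hpt : ∀ t (α : Metric.sphere (0 : E3) 1),
      E4.ofTimeSpace t ((κ' * t) • (α : E3)) = t • e α := by
    intro t α
    rw [he]
    simp only []
    rw [← ofTimeSpace_self_smul, smul_smul, mul_comm t κ']
  have hmem' : ∀ t, T < t → ∀ α : Metric.sphere (0 : E3) 1, t • e α ∈ W := by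
    intro t ht α
    rw [← hpt]
    exact hmem t ht _ (hnorm t (hT.trans ht) α)
  -- continuity of the angular integral by dominated convergence
  have hG : ContinuousOn (fun t ↦ ∫ α, P (t • e α) ∂(volume : Measure E3).toSphere) (Set.Ioi T) := by
    refine continuousOn_of_dominated (bound := fun _ ↦ C) ?_ ?_ (integrable_const C) ?_
    · intro t ht
      have hc : Continuous fun α : Metric.sphere (0 : E3) 1 ↦ P (t • e α) :=
        hP.comp_continuous (he_cont.const_smul t) (hmem' t ht)
      exact hc.aestronglyMeasurable
    · intro t ht
      refine Filter.Eventually.of_forall fun α ↦ ?_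
      rw [Real.norm_eq_abs, ← hpt]
      exact hbd t ht _ (hnorm t (hT.trans ht) α)
    · refine Filter.Eventually.of_forall fun α ↦ ?_
      have hsm : Continuous fun t : ℝ ↦ t • e α := continuous_id.smul continuous_const
      exact hP.comp hsm.continuousOn fun t ht ↦ hmem' t ht α
  have hprod : ContinuousOn (fun t ↦ (κ' * t) ^ 2 *
      ∫ α, P (t • e α) ∂(volume : Measure E3).toSphere) (Set.Ioi T) :=
    ((continuous_const.mul continuous_id).pow 2).continuousOn.mul hG
  refine hprod.congr fun t ht ↦ ?_
  have ht0 : 0 < t := hT.trans ht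
  have hr : 0 < κ' * t := by positivity
  rw [Literature.MeasureTheory.Hausdorff.setIntegral_sphere_euclideanHausdorff_three
    finrank_euclideanSpace_fin hr, Literature.Analysis.FluidPDE.sphereIntegral_def, smul_eq_mul]
  congr 1
  refine integral_congr_ae (Filter.Eventually.of_forall fun α ↦ ?_)
  show P (E4.ofTimeSpace t ((κ' * t) • (α : E3))) = P (t • e α)
  rw [hpt]

/-! ### The stub -/

/-- **STUB 3 `stub_wallInflux` of line `momentum-variation-is-paid-in-energy` (crux `InertialRecession`,
stmt-FinalStateConjecture-10166): the far-influx budget from the cone weight.** For `N ≥ 1` and every wall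
speed `κ′` with `κ² < κ′ < κ` there is `T` such that the energy exposure of the deviation
`h = Φ^*g − G(λ(t))` through the receding coordinate wall `{x⁰ = t, |y| = κ′t}` — all derivative orders
`m ≤ 3`, squared, integrated against `μHE[2]` — is integrable on `(T, ∞)`: eventually every wall point is
at lab distance `≥ (κ′−κ²)t` from every centre, lies in `U` and in the solid cone `{|y| ≤ κt}`, the weighted
clause gives `(1 + d^{7/4})‖D^m h‖ ≤ 1` there, so the integrand is `≤ 4((κ′−κ²)t)^{-7/2}` on a sphere of
area `4π(κ′t)²`, i.e. the wall integral is `O(t^{-3/2}) ∈ L¹` (the one place where `7/4 > 3/2` is spent);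
measurability in `t` from the polar form of the Hausdorff sphere integral and dominated convergence on
`volume.toSphere`, using smoothness of `h` on an open wall-neighbourhood inside `U`
(`contDiffAt_deviationExtend_of_bilin`). For `N = 0` the typed weight degenerates (`⨅ over Fin 0 = 0`),
hence the hypothesis `0 < N`. [cite: arXiv08110354, §2.6] [folklore] -/
theorem stub_wallInflux :
    open Literature.Geometry.Lorentzian in ∀ (X : Type) [TopologicalSpace X] [ChartedSpace E3 X] [IsManifold (𝓡 3) ((⊤ : ℕ∞) : WithTop ℕ∞) X] [T2Space X] [SecondCountableTopology X] [ConnectedSpace X], ∀ D ∈ admissibleVacuumData X, ∀ 𝒟 : VacuumCauchyDevelopment D, 𝒟.IsMaximal → ∀ (N : ℕ) (M a rin : Fin N → ℝ) (Λ : Fin N → ℝ → lorentzGroup) (ξ : Fin N → ℝ → E3) (γ κ τ₀ : ℝ) (U : Opens E4) (Φ : U → 𝒟.carrier) (O : Set 𝒟.carrier), ((∀ i, Kerr.IsSubextremal (M i) (a i) ∧ Kerr.rMinus (M i) (a i) < rin i ∧ rin i < Kerr.rPlus (M i) (a i)) ∧ (∀ i t, |((Λ i t : E4 ≃L[ℝ]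 E4) (E4.basisVector 0)) 0| ≤ γ) ∧ (∀ i, ContDiff ℝ ((⊤ : ℕ∞) : WithTop ℕ∞) (ξ i) ∧ ContDiff ℝ ((⊤ : ℕ∞) : WithTop ℕ∞) (fun t ↦ ((Λ i t : E4 ≃L[ℝ] E4) : E4 →L[ℝ] E4))) ∧ (∀ i j, i ≠ j → Tendsto (fun t ↦ ‖ξ i t - ξ j t‖) atTop atTop) ∧ (0 < κ ∧ κ < 1 ∧ ∀ i, ∀ᶠ t in atTop, ‖ξ i t‖ ≤ κ ^ 2 * t) ∧ ({x : E4 | τ₀ < x 0 ∧ ∀ i, rin i < Kerr.radius (a i) (poincareInv (Λ i (x 0)) (E4.ofTimeSpace (x 0) (ξ i (x 0))) x)} ⊆ (U : Set E4)) ∧ let B : ModelBackground := ⟨U, fun x ↦ Minkowski.bilin + ∑ i, (boostedKerrBilin (Λ i (x 0)) (E4.ofTimeSpace (x 0) (ξ i (x 0))) (M i) (a i) x - Minkowski.bilin), fun x ↦ x 0, E4.spatialNorm⟩; ContMDiff 𝓘(ℝ, E4) (𝓡 4) ((⊤ : ℕ∞) : WithTop ℕ∞) Φ ∧ Topology.IsOpenEmbedding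 ((B.lateRegion τ₀).restrict Φ) ∧ Φ '' {x : U | τ₀ < x.1 0 ∧ ∀ i, Kerr.rPlus (M i) (a i) < Kerr.radius (a i) (poincareInv (Λ i (x.1 0)) (E4.ofTimeSpace (x.1 0) (ξ i (x.1 0))) x.1)} ⊆ O ∧ Tendsto (fun t ↦ 𝒟.toSpacetime.deviationCk B Φ 3 t) atTop (𝓝 0) ∧ Tendsto (fun t : ℝ ↦ ⨆ x ∈ {x : U | x.1 0 = t ∧ E4.spatialNorm x.1 ≤ κ * t}, ⨆ (m : ℕ) (_ : m ≤ 3), ENNReal.ofReal (1 + √(√((⨅ i, ‖E4.spatial x.1 - ξ i t‖) ^ 7))) * ‖iteratedFDeriv ℝ m (𝒟.toSpacetime.deviationExtend B Φ) x.1‖ₑ) atTop (𝓝 0) ∧ O = Summit.FinalStateConjecture.exteriorOf 𝒟.toCauchyDevelopment (Φ '' {x : U | τ₀ < x.1 0 ∧ ∀ i, Kerr.rPlus (M i) (a i) < Kerr.radius (a i) (poincareInv (Λ i (x.1 0)) (E4.ofTimeSpace (x.1 0) (ξ i (x.1 0))) x.1)}) ∧ ∀ t₁ : ℝ, τ₀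 < t₁ → O \ Φ '' {x : U | t₁ < x.1 0 ∧ ∀ i, Kerr.rPlus (M i) (a i) < Kerr.radius (a i) (poincareInv (Λ i (x.1 0)) (E4.ofTimeSpace (x.1 0) (ξ i (x.1 0))) x.1)} ⊆ 𝒟.metric.causalPast 𝒟.timeOrientation (Φ '' {x : U | x.1 0 = t₁ ∧ ∀ i, Kerr.rPlus (M i) (a i) < Kerr.radius (a i) (poincareInv (Λ i (x.1 0)) (E4.ofTimeSpace (x.1 0) (ξ i (x.1 0))) x.1)})) → 0 < N → ∀ κ' : ℝ, κ ^ 2 < κ' → κ' < κ → ∃ T : ℝ, IntegrableOn (fun t : ℝ ↦ ∫ y in Metric.sphere (0 : E3) (κ' * t), ∑ m ∈ Finset.range 4, ‖iteratedFDeriv ℝ m (𝒟.toSpacetime.deviationExtend (⟨U, fun x ↦ Minkowski.bilin + ∑ i, (boostedKerrBilin (Λ i (x 0)) (E4.ofTimeSpace (x 0) (ξ i (x 0))) (M i) (a i) x - Minkowski.bilin), fun x ↦ x 0, E4.spatialNorm⟩ : ModelBackground) Φ) (E4.ofTimeSpace t y)‖ ^ 2 ∂(μHE[2] : Measure E3))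 (Set.Ioi T) := by
  intro X _ _ _ _ _ _ D _ 𝒟 _ N M a rin Λ ξ γ κ τ₀ U Φ O hH hN κ' hκ'₁ hκ'₂
  obtain ⟨hpar, -, hsm, -, ⟨hκ0, hκ1, hcone⟩, hU, hB⟩ := hH
  obtain ⟨hΦ, -, -, -, hweight, -, -⟩ := hB
  -- abbreviations
  set B : ModelBackground := ⟨U, fun x ↦ Minkowski.bilin + ∑ i, (boostedKerrBilin (Λ i (x 0))
    (E4.ofTimeSpace (x 0) (ξ i (x 0))) (M i) (a i) x - Minkowski.bilin), fun x ↦ x 0,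
    E4.spatialNorm⟩ with hBdef
  set h : E4 → E4 →L[ℝ] E4 →L[ℝ] ℝ := 𝒟.toSpacetime.deviationExtend B Φ with hhdef
  set c : ℝ := κ' - κ ^ 2 with hcdef
  have hc0 : 0 < c := by rw [hcdef]; linarith
  have hκ'0 : 0 < κ' := lt_trans (by positivity) hκ'₁
  haveI : Nonempty (Fin N) := ⟨⟨0, hN⟩⟩
  -- Step 1: eventual facts in the lab time
  have ev1 : ∀ᶠ t in atTop, ∀ i, ‖ξ i t‖ ≤ κ ^ 2 * t := eventually_all.mpr hcone
  have ev2 : ∀ᶠ t in atTop, τ₀ < t := eventually_gt_atTop τ₀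
  have ev3 : ∀ᶠ t in atTop, ∀ i, a i ^ 2 + rin i ^ 2 < (c / 2 * t) ^ 2 := by
    refine eventually_all.mpr fun i ↦ ?_
    have ht : Tendsto (fun t : ℝ ↦ (c / 2 * t) ^ 2) atTop atTop :=
      (tendsto_pow_atTop two_ne_zero).comp (tendsto_id.const_mul_atTop (by positivity))
    exact ht.eventually_gt_atTop _
  have ev4 : ∀ᶠ t in atTop, (⨆ x ∈ {x : U | x.1 0 = t ∧ E4.spatialNorm x.1 ≤ κ * t},
      ⨆ (m : ℕ) (_ : m ≤ 3), ENNReal.ofReal (1 + √(√((⨅ i, ‖E4.spatial x.1 - ξ i t‖) ^ 7))) *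
        ‖iteratedFDeriv ℝ m h x.1‖ₑ) ≤ 1 :=
    hweight.eventually (Iic_mem_nhds one_pos)
  obtain ⟨T₁, hT₁⟩ := eventually_atTop.mp (ev1.and (ev2.and (ev3.and ev4)))
  obtain ⟨T, hT1, hTT₁⟩ : ∃ T : ℝ, 1 ≤ T ∧ T₁ < T :=
    ⟨max T₁ 0 + 1, by linarith [le_max_right T₁ 0], by linarith [le_max_left T₁ 0]⟩
  have hT0 : 0 < T := by linarith
  -- Step 2: an open wall-neighbourhood `W ⊆ U` on which `h` is smooth
  obtain ⟨W, hWdef⟩ : ∃ W : Set E4, W = {x | T₁ < x 0 ∧ (κ ^ 2 + c / 2) * x 0 < E4.spatialNorm x ∧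
    E4.spatialNorm x < κ * x 0} := ⟨_, rfl⟩
  have hc00 : Continuous fun x : E4 ↦ x 0 := (EuclideanSpace.proj (0 : Fin 4) (𝕜 := ℝ)).continuous
  have hcsn : Continuous E4.spatialNorm := continuous_norm.comp E4.spatial.continuous
  have hWo : IsOpen W := by
    rw [hWdef]
    refine (isOpen_lt continuous_const hc00).inter ((isOpen_lt ?_ hcsn).inter (isOpen_lt hcsn ?_))
    · exact continuous_const.mul hc00
    · exact continuous_const.mul hc00
  -- painted radii of points of `W` exceed `rin` and are positive
  have hWrad : ∀ x ∈ W, ∀ i, rin i < Kerr.radius (a i)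
      (poincareInv (Λ i (x 0)) (E4.ofTimeSpace (x 0) (ξ i (x 0))) x) ∧ 0 < Kerr.radius (a i)
      (poincareInv (Λ i (x 0)) (E4.ofTimeSpace (x 0) (ξ i (x 0))) x) := by
    intro x hx i
    rw [hWdef] at hx
    obtain ⟨hx1, hx2, hx3⟩ := hx
    obtain ⟨h1, h2, h3, -⟩ := hT₁ (x 0) hx1.le
    have hξi := h1 i
    have hd : c / 2 * x 0 ≤ ‖E4.spatial x - ξ i (x 0)‖ := by
      have := norm_sub_norm_le (E4.spatial x) (ξ i (x 0))
      have e : ‖E4.spatial x‖ = E4.spatialNorm x := rfl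
      rw [e] at this
      linarith
    have hx0 : 0 < x 0 := by
      have : (0 : ℝ) ≤ E4.spatialNorm x := E4.spatialNorm_nonneg x
      nlinarith [sq_nonneg κ]
    have hsq := sq_sub_sq_le_radius_poincareInv_sq (Λ i (x 0)) (a i) (x 0) (ξ i (x 0)) (x := x) rfl
    have h3i := h3 i
    have hd2 : (c / 2 * x 0) ^ 2 ≤ ‖E4.spatial x - ξ i (x 0)‖ ^ 2 :=
      pow_le_pow_left₀ (by positivity) hd 2
    have hr0 := Kerr.radius_nonneg (a i)
      (poincareInv (Λ i (x 0)) (E4.ofTimeSpace (x 0) (ξ i (x 0))) x)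
    have hrin : rin i ^ 2 < Kerr.radius (a i)
        (poincareInv (Λ i (x 0)) (E4.ofTimeSpace (x 0) (ξ i (x 0))) x) ^ 2 := by linarith
    refine ⟨lt_of_pow_lt_pow_left₀ 2 hr0 hrin, ?_⟩
    rcases hr0.lt_or_eq with hpos | hzero
    · exact hpos
    · rw [← hzero] at hrin
      nlinarith [sq_nonneg (rin i)]
  have hWU : W ⊆ (U : Set E4) := by
    intro x hx
    refine hU ⟨?_, fun i ↦ (hWrad x hx i).1⟩
    rw [hWdef] at hx
    obtain ⟨-, h2, -⟩ := hT₁ (x 0) hx.1.le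
    exact h2
  have hWsmooth : ContDiffOn ℝ ∞ h W := by
    intro x hx
    have hb : ContDiffAt ℝ ∞ B.bilin x :=
      contDiffAt_ansatzBilin' N M a Λ ξ (fun i ↦ (hsm i).2) (fun i ↦ (hsm i).1) x
        fun i ↦ (hWrad x hx i).2
    exact (contDiffAt_deviationExtend_of_bilin (𝓢 := 𝒟.toSpacetime) B hΦ ⟨x, hWU hx⟩
      hb).contDiffWithinAt
  -- the integrand `P = Σ_{m<4} ‖D^m h‖²` is continuous on `W`
  obtain ⟨P, hPdef⟩ : ∃ P : E4 → ℝ, P = fun z ↦ ∑ m ∈ Finset.range 4,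
    ‖iteratedFDeriv ℝ m h z‖ ^ 2 := ⟨_, rfl⟩
  have hPcont : ContinuousOn P W := by
    rw [hPdef]
    refine continuousOn_finsetSum _ fun m _ ↦ ?_
    have hm : (m : WithTop ℕ∞) ≤ ((⊤ : ℕ∞) : WithTop ℕ∞) := by exact_mod_cast le_top
    have h1 := (hWsmooth.continuousOn_iteratedFDerivWithin hm hWo.uniqueDiffOn).congr
      (fun z hz ↦ (iteratedFDerivWithin_of_isOpen m hWo hz).symm)
    exact (h1.norm).pow 2
  -- Step 3: wall points at lab times `t > T` lie in `W`; pointwise and integral bounds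
  have hκ'c : κ' = κ ^ 2 + c := by rw [hcdef]; ring
  have hwallW : ∀ t, T < t → ∀ y : E3, ‖y‖ = κ' * t → E4.ofTimeSpace t y ∈ W := by
    intro t ht y hy
    have ht0 : 0 < t := hT0.trans ht
    rw [hWdef]
    refine ⟨?_, ?_, ?_⟩
    · show T₁ < E4.ofTimeSpace t y 0
      rw [E4.ofTimeSpace_apply_zero]; exact hTT₁.trans ht
    · show (κ ^ 2 + c / 2) * E4.ofTimeSpace t y 0 < E4.spatialNorm (E4.ofTimeSpace t y)
      rw [E4.spatialNorm_ofTimeSpace, hy, E4.ofTimeSpace_apply_zero, hκ'c]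
      exact mul_lt_mul_of_pos_right (by linarith) ht0
    · show E4.spatialNorm (E4.ofTimeSpace t y) < κ * E4.ofTimeSpace t y 0
      rw [E4.spatialNorm_ofTimeSpace, hy, E4.ofTimeSpace_apply_zero]
      exact mul_lt_mul_of_pos_right hκ'₂ ht0
  have hbound : ∀ t, T < t → ∀ y : E3, ‖y‖ = κ' * t →
      P (E4.ofTimeSpace t y) ≤ 4 / √((c * t) ^ 7) := by
    intro t ht y hy
    obtain ⟨h1, -, -, h4⟩ := hT₁ t (hTT₁.trans ht).le
    rw [hPdef]
    exact wall_pointwise_bound (hT0.trans ht) hκ'₂ hc0 h1 h4 hy (hWU (hwallW t ht y hy))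
  have hP0 : ∀ z, 0 ≤ P z := fun z ↦ by
    rw [hPdef]
    exact Finset.sum_nonneg fun m _ ↦ by positivity
  have hβanti : ∀ t, T < t → 4 / √((c * t) ^ 7) ≤ 4 / √((c * T) ^ 7) := by
    intro t ht
    have : 0 < √((c * T) ^ 7) := by positivity
    gcongr
  -- Step 4: continuity of the wall integral in `t`
  have hcont : ContinuousOn (fun t ↦ ∫ y in Metric.sphere (0 : E3) (κ' * t),
      P (E4.ofTimeSpace t y) ∂(μHE[2] : Measure E3)) (Set.Ioi T) :=
    continuousOn_wallIntegral hPcont hT0 hκ'0 hwallW fun t ht y hy ↦ by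
      rw [abs_of_nonneg (hP0 _)]
      exact (hbound t ht y hy).trans (hβanti t ht)
  -- Step 5: the integral bound `≤ K t^{-3/2}` and integrability
  obtain ⟨K, hKdef⟩ : ∃ K : ℝ, K = 16 * Real.pi * κ' ^ 2 / (c ^ 3 * √c) := ⟨_, rfl⟩
  have hint_bound : ∀ t, T < t →
      ‖∫ y in Metric.sphere (0 : E3) (κ' * t), P (E4.ofTimeSpace t y) ∂(μHE[2] : Measure E3)‖ ≤
        K * t ^ (-(3 / 2 : ℝ)) := by
    intro t ht
    have ht0 : 0 < t := hT0.trans ht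
    have hr : 0 < κ' * t := by positivity
    have hct : 0 < c * t := by positivity
    have hmeas : (μHE[2] : Measure E3) (Metric.sphere (0 : E3) (κ' * t)) =
        ENNReal.ofReal (4 * Real.pi * (κ' * t) ^ 2) :=
      Literature.MeasureTheory.Hausdorff.euclideanHausdorffMeasure_sphere_fin_three hr
    have h1 := norm_setIntegral_le_of_norm_le_const (μ := (μHE[2] : Measure E3))
      (s := Metric.sphere (0 : E3) (κ' * t)) (f := fun y ↦ P (E4.ofTimeSpace t y))
      (C := 4 / √((c * t) ^ 7)) (by rw [hmeas]; exact ENNReal.ofReal_lt_top) (fun y hy ↦ by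
        rw [Real.norm_of_nonneg (hP0 _)]
        exact hbound t ht y (mem_sphere_zero_iff_norm.mp hy))
    refine h1.trans (le_of_eq ?_)
    have hsc : 0 < √c := Real.sqrt_pos.mpr hc0
    have hst : 0 < √t := Real.sqrt_pos.mpr ht0
    rw [measureReal_def, hmeas, ENNReal.toReal_ofReal (by positivity), rpow_neg_three_halves ht0,
      hKdef, sqrt_pow_seven hct.le, Real.sqrt_mul hc0.le t]
    field_simp
    ring
  refine ⟨T, ?_⟩
  have hmajor : IntegrableOn (fun t : ℝ ↦ K * t ^ (-(3 / 2 : ℝ))) (Set.Ioi T) :=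
    (integrableOn_Ioi_rpow_of_lt (by norm_num) hT0).const_mul K
  subst hPdef
  refine Integrable.mono' hmajor (hcont.aestronglyMeasurable measurableSet_Ioi) ?_
  exact (ae_restrict_iff' measurableSet_Ioi).mpr (Filter.Eventually.of_forall fun t ht ↦
    hint_bound t ht)

end Summit.FinalStateConjecture.FinalStateConjecture.Theorems.InertialRecession.WallInflux

end
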